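import Literature.Claims.NS.Wayman2026
import Literature.Analysis.FluidPDE.BeltramiFlows

/-!
# Solo refutation — C154 `Wayman2026` (J. Wayman, «Global Regularity for the Three-Dimensional
# Navier–Stokes Equations on T³ from Cl(1,6) Casimir Geometry», Zenodo 18719808, 36 pp.)

D-0090 «where NS proofs break» map, cell `ns-claims`; refuter of record ns-claims-refuter-7 g4 (blind
prediction sealed e93b0c8e961f6b12 by refuter-7 g3 before TYPED, adopted 11:10Z, revealed at TYPED).
Skeleton of record: `Literature.Claims.NS.Wayman2026` (typist-9 g5, p527523, sha16 d6abd84c03fabeb6).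
Text of record = pin `census/texts/Wayman2026/` (PDF sha16 e577f370cc8e4527; PDF page = printed page;
`l.N` = pin line).

**Token = first failing step in PRINT ORDER on the composition path `claim_of_steps` (binder `h9`)**
= `Step_T9` (skeleton l.309) = Thm 9 (Continuous-time absolute stability) display (53) p.21 l.2–17
(= abstract p.3 l.4–7 = Thm 13 (2) p.31 l.6–14): «for every smooth divergence-free u₀ on T³(a*), the
peak vorticity decays geometrically at stroboscopic times: ‖ω(kτ)‖_{L∞} ≤ ‖ω₀‖_{L∞} γ^k», `γ =
(π²−3)/(2√3π) ≈ 0.631`, `τ = 2π/√3`, EVERY `ν > 0`. The typed steps that precede it in print —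
`Step_L2` (Lemma 2 p.7), `Step_P4` (Prop 4 (26) p.8), `Step_P9` (Prop 9 (44) p.16), `Step_T7` (Thm 7 (48)
p.17, `thm7_of_steps` PROVED), Thm 8 (50) p.18 (`thm8_loopGain` PROVED) — are TRUE-type.

**Class: FALSE LEMMA (countermodel)** — `not_Step_T9` below. Witness: the slowest Stokes/Beltrami shear
mode of the torus `T³(a*)`, `u(t,x) = e^{−νκ²t}(sin κx₃, cos κx₃, 0)`, `κ = 1/a* = √3/π` (period `2π/κ =
2πa* = per`), pressure `−½e^{−2νκ²t}` (constant in space): an exact `per`-periodic classical solution of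
(15)–(16) with vanishing nonlinearity, `curl u = κu`, `‖ω(t)‖_{L∞} = κe^{−νκ²t}`. Over one interaction time
the peak vorticity contracts by `e^{−νκ²τ} = e^{−2√3ν/π}`, which exceeds `γ` for every
`ν < π ln(1/γ)/(2√3) ≈ 0.4175`; at `ν = 1/4`, `k = 1`: `e^{−√3/(2π)} ≈ 0.759 > γ ≈ 0.631` (in kernel:
`γ < 16/25 < 7/10 ≤ 1 − x ≤ e^{−x}` for `x = 2√3ν/π ≤ 0.2775`). The same solution is a global Clay-sense
solution, so **Thm 13 (2) as printed (`Thm13_2 per tau`, l.207) is false and with it the typed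
`ClaimedTheorem` (l.221, conjunct 2)** — recorded alongside (`not_Thm13_2`, `not_Thm13_asPrinted`); Thm 13
(1) (= Clay (B) up to period scaling, `clay_of_thm13_1`) is of course untouched. No smallness / short-time
regime was dropped: the print asserts (53) for «any ν > 0, any smooth data» (Thm 9 p.21 l.9–12, Thm 13
p.30 l.52–54, Prop 14). Standard axioms only.

WHAT THIS IS NOT: not a claim about NS regularity or blow-up; not a claim about any author beyond the
typed locator. [cite: Wayman2026]
-/

set_option linter.dupNamespace false

noncomputable section

open Real Set

namespace Summit.NavierStokesRegularity.NavierStokesRegularity.Theorems.Wayman2026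

open Literature.Analysis.FluidPDE Literature.Claims.NS.Wayman2026

/-! ## §1 The shear/Beltrami wave `v_κ(x) = (sin κx₃, cos κx₃, 0)` -/

/-- Pure dilation under the curl: `curl (U(c ·))(y) = c • (curl U)(c y)` (chain rule for the linear map
`z ↦ c z`; no differentiability hypothesis needed). [folklore] -/
theorem curl_comp_smul (U : E3 → E3) (c : ℝ) (y : E3) :
    curl (fun z => U (c • z)) y = c • curl U (c • y) := by
  rw [curl_eq_curlCLM, curl_eq_curlCLM, _root_.fderiv_comp_smul, map_smul]

/-- The single-mode shear wave `v_κ(x) = (sin κx₃, cos κx₃, 0)`: the ABC flow with `(A,B,C) = (1,0,0)`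
dilated by `κ` (Majda–Bertozzi Example 2.8). [cite: MajdaBertozziCUP2002, §2.3.2 Example 2.8] -/
def wave (κ : ℝ) (x : E3) : E3 := ABC.abc 1 0 0 (κ • x)

/-- `|(sin y₃, cos y₃, 0)| = 1`. [folklore] -/
theorem norm_abc100 (y : E3) : ‖ABC.abc 1 0 0 y‖ = 1 := by
  rw [EuclideanSpace.norm_eq, Fin.sum_univ_three]
  simp [sin_sq_add_cos_sq]

/-- `|v_κ(x)| = 1` everywhere. [folklore] -/
theorem norm_wave (κ : ℝ) (x : E3) : ‖wave κ x‖ = 1 := norm_abc100 _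

/-- `v_κ` is smooth. [folklore] -/
theorem contDiff_wave (κ : ℝ) {n : WithTop ℕ∞} : ContDiff ℝ n (wave κ) :=
  (ABC.contDiff_abc 1 0 0).comp (contDiff_const_smul κ)

/-- `div v_κ = 0`. [folklore] -/
theorem isDivFree_wave (κ : ℝ) : VectorCalculus.IsDivFree (wave κ) :=
  (ABC.isDivFree_abc 1 0 0).comp_smul κ

/-- `curl v_κ = κ v_κ` (strong Beltrami with eigenvalue `κ`). [cite: MajdaBertozziCUP2002, §2.3.2 Prop. 2.10] -/
theorem curl_wave (κ : ℝ) (x : E3) : curl (wave κ) x = κ • wave κ x := by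
  unfold wave
  rw [curl_comp_smul, ABC.curl_abc]

/-- `v_κ` is a strong Beltrami field. [cite: MajdaBertozziCUP2002, §2.3.2 Prop. 2.10] -/
theorem isBeltrami_wave (κ : ℝ) : IsBeltrami (wave κ) fun _ => κ := fun x => curl_wave κ x

/-- `v_κ` is `2π/κ`-periodic in every coordinate direction (`κ ≠ 0`). [folklore] -/
theorem wave_periodic (κ : ℝ) (hκ : κ ≠ 0) (x : E3) (j : Fin 3) :
    wave κ (x + (2 * π / κ) • EuclideanSpace.single j 1) = wave κ x := by
  unfold wave
  have hc : κ • (x + (2 * π / κ) • EuclideanSpace.single j (1:ℝ)) =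
      κ • x + (2 * π) • EuclideanSpace.single j 1 := by
    rw [smul_add, smul_smul, mul_div_cancel₀ _ hκ]
  rw [hc]
  ext i
  fin_cases j <;> fin_cases i <;> simp [ABC.abc, sin_add_two_pi, cos_add_two_pi]

/-! ## §2 The exact viscous solution `u(t) = e^{−νκ²t} v_κ` and its peak vorticity -/

/-- The viscous wave `u(t,x) = e^{−κ²νt} v_κ(x)` with Bernoulli pressure is a classical Navier–Stokes
solution on all of `ℝ × E3` (no force). [cite: MajdaBertozziCUP2002, §2.3.2 p. 61] -/
theorem ns_wave (ν κ : ℝ) :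
    IsClassicalNSSolutionOn univ ν 0 (strongBeltramiVelocity ν κ (wave κ))
      (strongBeltramiPressure ν κ (wave κ)) :=
  isClassicalNSSolutionOn_strongBeltrami ν (isBeltrami_wave κ) (contDiff_wave κ) (isDivFree_wave κ)

/-- `curl u(t) = κ e^{−κ²νt} v_κ`. [folklore] -/
theorem curl_sol (ν κ t : ℝ) (x : E3) :
    curl (strongBeltramiVelocity ν κ (wave κ) t) x = (exp (-(κ ^ 2 * ν) * t) * κ) • wave κ x := by
  have h : strongBeltramiVelocity ν κ (wave κ) t = fun y => exp (-(κ ^ 2 * ν) * t) • wave κ y := rfl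
  rw [h, curl_const_smul (((contDiff_wave κ (n := 1)).differentiable one_ne_zero x)),
    curl_wave, smul_smul]

/-- `|ω(t,x)| = κ e^{−κ²νt}` everywhere (`κ ≥ 0`). [folklore] -/
theorem norm_curl_sol (ν κ t : ℝ) (hκ : 0 ≤ κ) (x : E3) :
    ‖curl (strongBeltramiVelocity ν κ (wave κ) t) x‖ = κ * exp (-(κ ^ 2 * ν) * t) := by
  rw [curl_sol, norm_smul, norm_wave, mul_one, Real.norm_of_nonneg (by positivity), mul_comm]

/-- `‖ω(t)‖_{L∞} = κ e^{−κ²νt}` in the skeleton's `supN`. [folklore] -/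
theorem supN_curl_sol (ν κ t : ℝ) (hκ : 0 ≤ κ) :
    supN (curl (strongBeltramiVelocity ν κ (wave κ) t)) = κ * exp (-(κ ^ 2 * ν) * t) := by
  unfold supN
  simp_rw [norm_curl_sol ν κ t hκ]
  exact ciSup_const

/-- `‖ω₀‖_{L∞} = κ` for the datum `v_κ`. [folklore] -/
theorem supN_curl_wave (κ : ℝ) (hκ : 0 ≤ κ) : supN (curl (wave κ)) = κ := by
  unfold supN
  simp_rw [curl_wave, norm_smul, norm_wave, mul_one, Real.norm_of_nonneg hκ]
  exact ciSup_const

/-! ## §3 The printed torus: `κ = 1/a* = √3/π`, period `2π/κ = per`, and the numerics `γ < e^{−νκ²τ}` -/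

/-- The wavenumber of the slowest mode on `T³(a*)`: `κ = √3/π = 1/a*` (`κ² = λ₁ = 3/π²`, Lemma 1 p.7).
[cite: Wayman2026, Lemma 1 (18) p.7] -/
def kap : ℝ := sqrt 3 / π

/-- `κ > 0`. [folklore] -/
theorem kap_pos : 0 < kap := by unfold kap; positivity

/-- `2π/κ = 2πa* = per`: the wave has exactly the printed period. [cite: Wayman2026, Def 5 p.7 l.23–26] -/
theorem two_pi_div_kap : 2 * π / kap = per := by
  unfold kap per aStar
  have hπ : π ≠ 0 := pi_ne_zero
  have h3 : sqrt 3 ≠ 0 := by positivity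
  field_simp

/-- `v_κ` is `per`-periodic in the skeleton's sense. [cite: Wayman2026, Def 5 p.7 l.23–26] -/
theorem isPer_wave : IsPer per (wave kap) := by
  intro j x
  rw [← two_pi_div_kap]
  exact wave_periodic kap kap_pos.ne' x j

/-- `√3 > 1.73`. [folklore] -/
theorem sqrt3_gt : (173 : ℝ) / 100 < sqrt 3 := by
  rw [show (173:ℝ)/100 = sqrt ((173/100)^2) by rw [sqrt_sq]; norm_num]
  exact sqrt_lt_sqrt (by norm_num) (by norm_num)

/-- `√3 < 1.733`. [folklore] -/
theorem sqrt3_lt : sqrt 3 < (1733 : ℝ) / 1000 := by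
  rw [show (1733:ℝ)/1000 = sqrt ((1733/1000)^2) by rw [sqrt_sq]; norm_num]
  exact sqrt_lt_sqrt (by norm_num) (by norm_num)

/-- `γ = (π²−3)/(2√3π) < 16/25` (numerically `γ ≈ 0.6312`). [cite: Wayman2026, Thm 8 (50) p.18] -/
theorem gam_lt : gam < 16 / 25 := by
  have hπ1 := pi_gt_d2
  have hπ2 := pi_lt_d2
  have h3 := sqrt3_gt
  unfold gam
  rw [div_lt_iff₀ (by positivity)]
  nlinarith

/-- `γ > 0`. [cite: Wayman2026, Thm 8 (50) p.18] -/
theorem gam_pos : 0 < gam := by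
  have hπ1 := pi_gt_three
  unfold gam
  exact div_pos (by nlinarith) (by positivity)

/-- For `x ≤ 3/10`: `γ < 16/25 < 7/10 ≤ 1 − x ≤ e^{−x}`. [folklore] -/
theorem gam_lt_exp_neg {x : ℝ} (hx : x ≤ 3 / 10) : gam < exp (-x) := by
  have h1 := gam_lt
  have h2 : -x + 1 ≤ exp (-x) := add_one_le_exp (-x)
  linarith

/-- `κ²τ = 2√3/π`. [cite: Wayman2026, Thm 13 (2) p.31 l.10–14] -/
theorem kap_sq_mul_tau : kap ^ 2 * tau = 2 * sqrt 3 / π := by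
  unfold kap tau
  have hπ : π ≠ 0 := pi_ne_zero
  have h3 : sqrt 3 ≠ 0 := by positivity
  have hs : sqrt 3 ^ 2 = 3 := sq_sqrt (by norm_num)
  field_simp

/-- `2√3/π < 1.11`. [folklore] -/
theorem two_sqrt3_div_pi_lt : 2 * sqrt 3 / π < 111 / 100 := by
  have hπ1 := pi_gt_d2
  have h3 := sqrt3_lt
  rw [div_lt_iff₀ pi_pos]
  nlinarith

/-- **The decisive comparison**: for `0 ≤ ν ≤ 1/4` the exact one-period contraction of the slowest mode
beats the printed loop gain, `γ < e^{−νκ²τ}` (`νκ²τ = 2√3ν/π ≤ 0.2775`). [cite: Wayman2026, Thm 9 (53) p.21] -/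
theorem gam_lt_decay {ν : ℝ} (hν0 : 0 ≤ ν) (hν : ν ≤ 1 / 4) :
    gam < exp (-(kap ^ 2 * ν) * ((1 : ℝ) * tau)) := by
  have hk : kap ^ 2 * ν * ((1 : ℝ) * tau) = (2 * sqrt 3 / π) * ν := by
    rw [one_mul, mul_comm (kap ^ 2) ν, mul_assoc, kap_sq_mul_tau]; ring
  rw [neg_mul, hk]
  apply gam_lt_exp_neg
  have h := two_sqrt3_div_pi_lt
  have : 0 ≤ 2 * sqrt 3 / π := by positivity
  nlinarith

/-! ## §4 The wave is in the typed classes `IsDatum` / `IsSol` / `IsGlobalSol` -/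

/-- The viscous wave on `T³(a*)`. [cite: MajdaBertozziCUP2002, §2.3.2 p. 61] -/
def solU (ν : ℝ) : ℝ → E3 → E3 := strongBeltramiVelocity ν kap (wave kap)

/-- Its (spatially constant) Bernoulli pressure `−½e^{−2νκ²t}`. [cite: MajdaBertozziCUP2002, §2.3.2 p. 61] -/
def solP (ν : ℝ) : ℝ → E3 → ℝ := strongBeltramiPressure ν kap (wave kap)

/-- `v_κ` is an admissible datum on `T³(a*)` (smooth, divergence-free, `per`-periodic).
[cite: Wayman2026, Def 5 p.7 l.21–26] -/
theorem isDatum_wave : IsDatum per (wave kap) :=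
  ⟨contDiff_wave kap, fun x => isDivFree_wave kap x, isPer_wave⟩

/-- The velocity slices are `per`-periodic. [folklore] -/
theorem isPer_solU (ν t : ℝ) : IsPer per (solU ν t) := by
  intro j x
  simp only [solU, strongBeltramiVelocity_apply]
  rw [isPer_wave j x]

/-- The pressure slices are constant in space, hence `per`-periodic. [folklore] -/
theorem isPer_solP (ν t : ℝ) : IsPer per (solP ν t) := by
  intro j x
  simp only [solP, strongBeltramiPressure, norm_wave]

/-- The wave is a class solution on `[0,T)` from the datum `v_κ`, for every `T` and every `ν`
(Thm 9 Step 1's class, skeleton `IsSol`). [cite: Wayman2026, Thm 9 Step 1 p.21 l.20–23] -/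
theorem isSol_wave (ν T : ℝ) : IsSol per ν T (wave kap) (solU ν) (solP ν) where
  datum := isDatum_wave
  classical := (ns_wave ν kap).mono (subset_univ _) (uniqueDiffOn_Ico 0 T)
  initial := strongBeltramiVelocity_zero ν kap (wave kap)
  perU t _ := isPer_solU ν t
  perP t _ := isPer_solP ν t

/-- The wave is a global Clay-sense solution on `T³(a*)` (skeleton `IsGlobalSol`), via the tree's bridge
`isNavierStokesSolution_and_smooth_iff`. [cite: Wayman2026, Thm 13 (1) p.30 l.55 – p.31 l.5] -/
theorem isGlobalSol_wave (ν : ℝ) : IsGlobalSol per ν (wave kap) (solU ν) (solP ν) := by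
  have hcl : IsClassicalNSSolutionOn (Ici 0) ν 0 (solU ν) (solP ν) :=
    (ns_wave ν kap).mono (subset_univ _) (uniqueDiffOn_Ici 0)
  obtain ⟨hns, hu, hp⟩ :=
    (isNavierStokesSolution_and_smooth_iff).2 ⟨hcl, strongBeltramiVelocity_zero ν kap (wave kap)⟩
  exact ⟨hu, hp, hns, fun t _ => isPer_solU ν t, fun t _ => isPer_solP ν t⟩

/-! ## §5 The token: `Step_T9` (Thm 9 (53) p.21) is false -/

/-- **`¬ Step_T9`** — Thm 9 (53) p.21 l.2–17 («‖ω(kτ)‖_{L∞} ≤ ‖ω₀‖_{L∞} γ^k» for every datum, every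
`ν > 0`, along every class solution) fails at `ν = 1/4`, `T = τ + 1`, `k = 1` on the slowest shear
mode of `T³(a*)`: `‖ω(τ)‖_{L∞} = κe^{−νκ²τ} = κe^{−√3/(2π)} > κγ = ‖ω₀‖_{L∞}γ`. FIRST FAILING STEP (print
order and composition path `claim_of_steps`, binder `h9`). [cite: Wayman2026, Thm 9 (53) p.21 l.2–17] -/
theorem not_Step_T9 : ¬ Step_T9 := by
  intro h
  have hτ : 0 < tau := by unfold tau; positivity
  have hlt : ((1 : ℕ) : ℝ) * tau < tau + 1 := by rw [Nat.cast_one, one_mul]; linarith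
  have h1 := h (1 / 4) (tau + 1) (wave kap) (solU (1 / 4)) (solP (1 / 4)) (by norm_num)
    (isSol_wave (1 / 4) (tau + 1)) 1 hlt
  rw [Nat.cast_one, pow_one, solU, supN_curl_sol _ _ _ kap_pos.le, supN_curl_wave _ kap_pos.le] at h1
  have h2 := gam_lt_decay (ν := 1 / 4) (by norm_num) le_rfl
  nlinarith [kap_pos, h1, h2]

/-! ## §6 Alongside: the claimed statement's part (2) is false as printed -/

/-- **`¬ Thm13_2 per tau`** — Thm 13 (2) p.31 l.6–14 («The peak vorticity decays geometrically:
‖ω(kτ)‖_{L∞} ≤ ‖ω₀‖_{L∞} γ^k») fails along the same GLOBAL Clay-sense solution at `ν = 1/4`, `k = 1`.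
[cite: Wayman2026, Thm 13 (2) p.31 l.6–14] -/
theorem not_Thm13_2 : ¬ Thm13_2 per tau := by
  intro h
  have h1 := h (1 / 4) (by norm_num) (wave kap) isDatum_wave (solU (1 / 4)) (solP (1 / 4))
    (isGlobalSol_wave (1 / 4)) 1
  rw [Nat.cast_one, pow_one, solU, supN_curl_sol _ _ _ kap_pos.le, supN_curl_wave _ kap_pos.le] at h1
  have h2 := gam_lt_decay (ν := 1 / 4) (by norm_num) le_rfl
  nlinarith [kap_pos, h1, h2]

/-- **`¬ ClaimedTheorem` (C154)** — Theorem 13 p.30–31 AS PRINTED (the conjunction of its three parts on `T³(a*)`)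
is false, through part (2). Part (1) (global regularity = Clay (B) up to period scaling) is not touched by
this file. [cite: Wayman2026, Thm 13 p.30 l.49 – p.31 l.17] -/
theorem not_Thm13_asPrinted : ¬ Literature.Claims.NS.Wayman2026.ClaimedTheorem :=
  fun h => not_Thm13_2 h.2.1

end Summit.NavierStokesRegularity.NavierStokesRegularity.Theorems.Wayman2026

end
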